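import Mathlib
import Summits.Ventures.PercRepro2.TypedReduce5
import Summits.Ventures.PercRepro2.TypedUntouched

/-!
# The typed reduction calculus with the root-untouched base (blind cell PercRepro2, night-3 g5,
2026-08-25; `proofs/NIGHT3-CERT.md` §14)

`RedM5U := RedMGen Base5U` with `Base5U = |F| ≤ 5 ∨ C_z(a₁) untouched ∨ C_z(a₂) untouched`:
the rules of `RedM` (contraction, root pair, loop, leaf, pendant `b` / `o`, parallel, series)
over the base «at most five typed edges» (`FiveTypedAll`) or «a pinned root cluster untouched by
the typed edges» (`TypedUntouched`, where the count is `0`).  `typedCount_nonneg_of_redM5U` is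
row 2′TRI on this class; `Gc_nonneg_of_redM5U` / `ZDelta_of_redM5U` are the weighted corollaries
and `redM5U_of_redM5` the inclusion `RedM5 ⊆ RedM5U`.
-/

namespace Summit.Ventures.PercRepro2

open UnionCluster

namespace CovForm

namespace TypedRed

open Contract

section RedM5U

variable {V : Type*} {E : Type*} [DecidableEq V] [Fintype E] [DecidableEq E]

/-- The base of `RedM5U`: at most five typed edges, or a pinned root cluster untouched by the
typed edges. -/
def Base5U (ends : E → Sym2 V) (_o a₁ a₂ _a₃ _b : V) (F : Finset E) (z : Config E)
    (_τ : E → ℕ) : Prop :=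
  F.card ≤ 5 ∨ Untouched.UntouchedBy ends F z a₁ ∨ Untouched.UntouchedBy ends F z a₂

/-- **The reducible class with base `|F| ≤ 5 ∨ root untouched`.** -/
abbrev RedM5U : (E → Sym2 V) → V → V → V → V → V → Finset E → Config E → (E → ℕ) → Prop :=
  RedMGen Base5U

variable {R : Type*} [Field R] [LinearOrder R] [IsStrictOrderedRing R]

omit [DecidableEq V] in
/-- The typed count is nonnegative on the base `Base5U`. -/
theorem typedCount_nonneg_of_base5U (ends : E → Sym2 V) (o a₁ a₂ a₃ b : V) (F : Finset E)
    (z : Config E) (τ : E → ℕ) (hB : Base5U ends o a₁ a₂ a₃ b F z τ)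
    (hτ : ∀ e ∈ F, τ e = 1 ∨ τ e = 2) :
    0 ≤ typedCount F z τ (K3 ends o a₁ a₂ a₃ b : Config E → Config E → Config E → R) := by
  rcases hB with h5 | h1 | h2
  · exact TwoTyped.typedCount_nonneg_of_card_le_five' ends o a₁ a₂ a₃ b F h5 z τ hτ
  · rw [Untouched.typedCount_eq_zero_of_untouched_a1 ends o a₁ a₂ a₃ b F z τ hτ h1]
  · rw [Untouched.typedCount_eq_zero_of_untouched_a2 ends o a₁ a₂ a₃ b F z τ hτ h2]

/-- **Row 2′TRI on `RedM5U`**: every typed count of `K₃` with mixed types whose instance reduces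
to at most five typed edges, or to an instance with a pinned root cluster untouched, is
nonnegative. -/
theorem typedCount_nonneg_of_redM5U {ends : E → Sym2 V} {o a₁ a₂ a₃ b : V} {F : Finset E}
    {z : Config E} {τ : E → ℕ} (h : RedM5U ends o a₁ a₂ a₃ b F z τ)
    (hτ : ∀ e ∈ F, τ e = 1 ∨ τ e = 2) :
    0 ≤ typedCount F z τ (K3 ends o a₁ a₂ a₃ b : Config E → Config E → Config E → R) :=
  typedCount_nonneg_of_redMGen (fun ends o a₁ a₂ a₃ b F z τ hB hτ =>
    typedCount_nonneg_of_base5U ends o a₁ a₂ a₃ b F z τ hB hτ) h hτ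

omit [Fintype E] in
/-- `RedM5 ⊆ RedM5U`. -/
theorem redM5U_of_redM5 {ends : E → Sym2 V} {o a₁ a₂ a₃ b : V} {F : Finset E} {z : Config E}
    {τ : E → ℕ} (h : RedM5 ends o a₁ a₂ a₃ b F z τ) : RedM5U ends o a₁ a₂ a₃ b F z τ := by
  induction h with
  | base ends o a₁ a₂ a₃ b F z τ hF =>
    exact RedMGen.base ends o a₁ a₂ a₃ b F z τ (Or.inl hF)
  | @contract ends o a₁ a₂ a₃ b F z τ g u v hg hgF hz _ ih =>
    exact RedMGen.contract ends o a₁ a₂ a₃ b F z τ hg hgF hz ih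
  | @rootPair ends o a₁ a₂ a₃ b F z τ f hf hfF =>
    exact RedMGen.rootPair ends o a₁ a₂ a₃ b F z τ hf hfF
  | @loop ends o a₁ a₂ a₃ b F z τ f u hf hfF _ ih =>
    exact RedMGen.loop ends o a₁ a₂ a₃ b F z τ hf hfF ih
  | @leaf ends o a₁ a₂ a₃ b F z τ f l u hf hlu hlo hl1 hl2 hl3 hlb hfF hcl _ ih =>
    exact RedMGen.leaf ends o a₁ a₂ a₃ b F z τ hf hlu hlo hl1 hl2 hl3 hlb hfF hcl ih
  | @pendantB ends o a₁ a₂ a₃ b F z τ f u hf hbu hbo hb1 hb2 hb3 hfF hcl _ ih =>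
    exact RedMGen.pendantB ends o a₁ a₂ a₃ b F z τ hf hbu hbo hb1 hb2 hb3 hfF hcl ih
  | @pendantO ends o a₁ a₂ a₃ b F z τ f u hf hou ho1 ho2 ho3 hob hfF hcl _ ih =>
    exact RedMGen.pendantO ends o a₁ a₂ a₃ b F z τ hf hou ho1 ho2 ho3 hob hfF hcl ih
  | @parallel ends o a₁ a₂ a₃ b F z τ e f hef hpar heF hfF _ _ _ ih1 ih2 ih3 =>
    exact RedMGen.parallel ends o a₁ a₂ a₃ b F z τ hef hpar heF hfF ih1 ih2 ih3
  | @series ends o a₁ a₂ a₃ b F z τ e f hef u w v he hf hwu hwv hwo hw1 hw2 hw3 hwb heF hfF hcl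
      _ _ _ ih0 ih1 ih2 =>
    exact RedMGen.series ends o a₁ a₂ a₃ b F z τ hef he hf hwu hwv hwo hw1 hw2 hw3 hwb heF hfF
      hcl ih0 ih1 ih2

/-- **(HCOV) on weight vectors whose fractional edges reduce in `RedM5U`**. -/
theorem Gc_nonneg_of_redM5U (ends : E → Sym2 V) (o a₁ a₂ a₃ b : V) (p : E → R)
    (hp : IsProbVec p)
    (hred : ∀ G : Finset E, G ⊆ (Finset.univ.filter fun e => p e ≠ 0 ∧ p e ≠ 1) →
      ∀ (z : Config E) (σ : E → ℕ), (∀ e ∈ G, σ e = 1 ∨ σ e = 2) →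
        RedM5U ends o a₁ a₂ a₃ b G z σ) :
    0 ≤ Gc p ends o a₁ a₂ a₃ b := by
  rw [hcov_cubic p ends o a₁ a₂ a₃ b (fun _ => 0)]
  refine TwoTyped.triSum_nonneg_of_typedCount_subset (K3 ends o a₁ a₂ a₃ b)
    (Finset.univ.filter fun e => p e ≠ 0 ∧ p e ≠ 1) ?_ p (fun e => ⟨hp.nonneg e, hp.le_one e⟩) ?_ ∅
    (Finset.empty_subset _) (fun _ => 0) (fun e he => absurd he (Finset.notMem_empty e))
  · intro G hG z σ hσ
    exact typedCount_nonneg_of_redM5U (hred G hG z σ hσ) hσ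
  · intro e he
    simp only [Finset.mem_filter, Finset.mem_univ, true_and, not_and, not_not] at he
    by_cases h : p e = 0
    · exact Or.inl h
    · exact Or.inr (he h)

/-- **The crux of record (ZΔ) on weight vectors whose fractional edges reduce in `RedM5U`.** -/
theorem ZDelta_of_redM5U [Fintype V] (ends : E → Sym2 V) (o a₁ a₂ a₃ b : V) (p : E → R)
    (hp : IsProbVec p)
    (hred : ∀ G : Finset E, G ⊆ (Finset.univ.filter fun e => p e ≠ 0 ∧ p e ≠ 1) →
      ∀ (z : Config E) (σ : E → ℕ), (∀ e ∈ G, σ e = 1 ∨ σ e = 2) →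
        RedM5U ends o a₁ a₂ a₃ b G z σ)
    (hord : prob p (connEvent ends a₁ b) ≤ prob p (connEvent ends a₂ b)) :
    ZDelta p ends o a₁ a₂ a₃ b :=
  ZDelta_of_HCov p hp ends hord (Gc_nonneg_of_redM5U ends o a₁ a₂ a₃ b p hp hred)

end RedM5U

end TypedRed

end CovForm

end Summit.Ventures.PercRepro2
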